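import Mathlib
import HarnessLib
import Summits.HubbardSuperconductivity.HubbardSuperconductivity.Theorems.KLProgrammeKLRegimeVolumeLimitFlowFrames
import Summits.HubbardSuperconductivity.HubbardSuperconductivity.Theorems.KLProgrammeKLRegimeSplitSlotsV17F2

/-!
# The flow frames of two volumes agree up to `O(1/L)` FROM THE REV-2 TOWER `klPredsV17F2` — the re-key of …VolumeLimitFlowFrames §3/§5 to the cured bundle
# (S1 rev 2 = successor module `…SplitSlotsV17F2`, p527694: `TwoLegStepV17F2`/`histV17F2`/`EngineBoundsAtV17F2`; the flow frames `klFlowFrameU`, the readings,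
# (E3a-F) `TwoLegReadJetsF`, (E3f-F) `TwoLegVolumeRateF`, `RenormFlowAtV17F` and the (T-a) dummy `frameOK` are UNCHANGED)
# (seat hubbard-kl-k3c5-p3 g7, VL co-registrant; technique «OS-positivity-free direct assembly»)

* §1 `flowFrames_twoVolume_of_towerV17F2`, `abs_eval_klFlowFrameU_le_of_towerV17F2` — as in …FlowFrames, reading the rev-2 two-leg slot (same three conjuncts,
  history `histV17F2`);
* §2 `klPredsV17F2_frameOK_frameOK`, **`volumeLimitTextV17F2_of_framedNestedFlowText`** — the rev-2 VL child text `VolumeLimitP2 klPredsV17F2 FinalTwoLegVolLimitEx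
  klWindowC` from the framed nested export in the flow's own frames («cauchy v8-F2»'s stub; token re-key `klPredsV17F ↦ klPredsV17F2` of v8-F 3687737755be3874).

* §3 (appendix) `framedFlowNested_of_framedFlowSite`, `volumeLimitTextV17F2_of_framedFlowSiteText` — the same export delivered in POSITION SPACE (site kernel at
  `K^{(L,M)}` vs the periodised site kernel of the nested volume at `K^{(L″,M)}`; Fourier inversion + exact periodisation of sampled characters, frame-blind).

Everything is proved; no definition; nothing is asserted about the model.
-/

noncomputable section

namespace Summit.HubbardSuperconductivity.HubbardSuperconductivity.Theorems.TwoPointAssembly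

set_option linter.dupNamespace false -- summit = problem name (single-conjunct summit), D-0017

open Finset Filter Topology Literature.MathematicalPhysics.QuantumLattice Literature.Probability.LatticeModels GrassmannAlgebra
open Literature.MathematicalPhysics.QuantumLattice.FermiRG
open Summit.HubbardSuperconductivity.HubbardSuperconductivity.Theorems.DispersionFlow
open Summit.HubbardSuperconductivity.HubbardSuperconductivity.Theorems.KLRegimeSplit
open Summit.HubbardSuperconductivity.HubbardSuperconductivity.Theorems.KLProgrammeLegKernels

/-! ## §1 From the V17F2 (rev-2) tower: two-volume agreement and a sup bound of the flow frames, scale by scale -/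

section Tower

variable {G : GeoConsts} {P : SplitConsts} {Q : EngConsts} {R : RenConsts} {β U μ : ℝ} {K₀ : TrigPolyC4v} {Lstar : ℕ} {Mstar : ℕ → ℕ}

/-- **The flow frames of two volumes agree up to `(Σ_{m<n} Q.CL β m)/L`, FROM THE TOWER.**  Under `TowerP klPredsV17F2 G P Q R β U μ K₀ Lstar Mstar`
(`μ ∈ klWindowC`): for `Lstar ≤ L ≤ L′`, `Mstar L ≤ M`, `Q.M0 β L ≤ M`, `Mstar L′ ≤ M′`, `Q.M0 β L′ ≤ M′`, every `n ≤ nScales β + 1` and every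
momentum `q`, `|K_n^{(L,M)}(q) − K_n^{(L′,M′)}(q)| ≤ (Σ_{m<n} Q.CL β m)/L`.  Per scale `m < n`: (E3f-F) at `(L, M, m)` with the reader's threshold
`Mq := Mstar` — its history antecedent at every larger volume is the tower itself (split, renorm, engine, reading jets, slopes at `j < m`) — gives
`sup_θ|ν_m^{(L,M)} − ν_m^{(L′,M′)}| ≤ Q.CL β m / L`; §1 passes it to the pieces (the readings are `C⁴` by (E3a-F) `TwoLegReadJetsF`); §2 sums. -/
theorem flowFrames_twoVolume_of_towerV17F2 (hμ : μ ∈ klWindowC) (hT : TowerP klPredsV17F2 G P Q R β U μ K₀ Lstar Mstar)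
    {L : ℕ} [NeZero L] (hL : Lstar ≤ L) {L' : ℕ} [NeZero L'] (hLL' : L ≤ L')
    {M : ℕ} [NeZero M] (hM₁ : Mstar L ≤ M) (hM₂ : Q.M0 β L ≤ M) {M' : ℕ} [NeZero M'] (hM'₁ : Mstar L' ≤ M') (hM'₂ : Q.M0 β L' ≤ M')
    {n : ℕ} (hn : n ≤ nScales β + 1) (q : Fin 2 → ℝ) :
    |(klFlowFrameU L M β U μ n).eval q - (klFlowFrameU L' M' β U μ n).eval q| ≤ (∑ m ∈ range n, Q.CL β m) / L := by
  have hL' : Lstar ≤ L' := hL.trans hLL'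
  -- the tower at the two volumes
  have hTL := hT L M hL hM₁
  have hTL' := hT L' M' hL' hM'₁
  rw [Finset.sum_div]
  refine abs_eval_klFlowFrameU_sub_le_sum β U μ n q fun m hm => ?_
  have hm' : m ≤ nScales β := by omega
  -- the two-leg slots at scale `m` of both volumes
  have h2 : TwoLegStepV17F2 L M G P Q R β U μ m := (hTL.1 m hm').2.2.2
  have h2' : TwoLegStepV17F2 L' M' G P Q R β U μ m := (hTL'.1 m hm').2.2.2
  obtain ⟨hread, -, hrate⟩ := h2
  obtain ⟨hread', -, -⟩ := h2'
  -- (E3f-F) at `(L, M, m)` with `Mq := Mstar`: the history antecedent from the tower at every larger volume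
  have hhist : ∀ (L₂ M₂ : ℕ) [NeZero L₂] [NeZero M₂], L ≤ L₂ → Q.M0 β L₂ ≤ M₂ → Mstar L₂ ≤ M₂ →
      ∀ j < m, histV17F2 L₂ M₂ G P Q R β U μ j ∧ TwoLegSlopes L₂ M₂ R β U μ (klFlowFrameU L₂ M₂ β U μ j) j := by
    intro L₂ M₂ _ _ hL₂ _ hM₂ j hj
    have hj' : j ≤ nScales β := by omega
    obtain ⟨hren, hspl, heng, htwo⟩ := (hT L₂ M₂ (hL.trans hL₂) hM₂).1 j hj'
    have htwo' : TwoLegStepV17F2 L₂ M₂ G P Q R β U μ j := htwo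
    exact ⟨⟨hspl, hren, heng, htwo'.1⟩, htwo'.2.1⟩
  have hν : ∀ θ : ℝ, |klLocalPart L M β U μ (klFlowFrameU L M β U μ m) m θ - klLocalPart L' M' β U μ (klFlowFrameU L' M' β U μ m) m θ| ≤
      Q.CL β m / L :=
    hrate Mstar hM₂ hM₁ hhist L' M' hLL' hM'₂ hM'₁
  exact abs_eval_klFlowPieceJackson_sub_le hμ m hread.1 hread'.1 hν q

/-- **Sup bound of the flow frames from the tower**: `|K_n^{(L,M)}(q)| ≤ Σ_{m<n} R.Gfr 0·uPow 0 U·4^{−2m}` for `Lstar ≤ L`, `Mstar L ≤ M`,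
`n ≤ nScales β + 1` ((I-F jets) of the renormalisation slot at every `m < n`; p2's `abs_evalM_klFlowFrameU_sub_le` against `K_0 = 0`). -/
theorem abs_eval_klFlowFrameU_le_of_towerV17F2 (hT : TowerP klPredsV17F2 G P Q R β U μ K₀ Lstar Mstar)
    {L : ℕ} [NeZero L] (hL : Lstar ≤ L) {M : ℕ} [NeZero M] (hM : Mstar L ≤ M) {n : ℕ} (hn : n ≤ nScales β + 1) (q : Fin 2 → ℝ) :
    |(klFlowFrameU L M β U μ n).eval q| ≤ ∑ m ∈ range n, R.Gfr 0 * uPow 0 U * (4 : ℝ) ^ ((((0 : ℕ) : ℤ) - 2) * (m : ℤ)) := by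
  have hTL := hT L M hL hM
  have hJ : ∀ m < n, FlowPieceJetsAt L M β U μ R m := by
    intro m hm
    have hm' : m ≤ nScales β := by omega
    have hren : RenormFlowAtV17F L M β U μ R m := (hTL.1 m hm').1
    exact hren.2.1
  have h := abs_evalM_klFlowFrameU_sub_le (Nat.zero_le n) hJ (WithLp.toLp 2 q)
  rw [klFlowFrameU_zero, Finset.range_eq_Ico] at *
  simpa [evalM_apply] using h

end Tower


/-! ## §2 The gen-7-flow (rev-2) VL child from ONE export: framed nested comparability in the flow's own frames -/

/-- `klPredsV17F2.frameOK ⇒ FrameOK` (the (T-a) conjunct of the dummy frame class). -/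
theorem klPredsV17F2_frameOK_frameOK (R : RenConsts) (U : ℝ) (N : ℕ) (μ : ℝ) (K : TrigPolyC4v) (h : klPredsV17F2.frameOK R U N μ K) :
    FrameOK R U N μ K := ((klPredsV17F2_frameOK_iff R U N μ K).1 h).2

/-- **THE GEN-7-FLOW VL CHILD FROM THE FLOW LINEAGE'S OWN-FRAME EXPORT ALONE** («cauchy v8-F2»): the child text
`VolumeLimitP2 klPredsV17F2 FinalTwoLegVolLimitEx klWindowC` follows from — inside the regime binders, for each Matsubara integer `n` — nested
same-momentum comparability, with a label-dependent threshold and rate, of the FRAMED last-scale carriers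
`klSelfEnergy L M β U μ (klFlowFrameU L M β U μ (nScales β + 1)) klE0 (nScales β + 1) (ω,k) 0` and
`klSelfEnergy L″ M β U μ (klFlowFrameU L″ M β U μ (nScales β + 1)) klE0 (nScales β + 1) (ω,k″) 0` (`L ∣ L″`, same cutoff, `matsubaraInt M ω = n`).
The comparability and boundedness of the two volumes' flow frames are supplied by the tower (§3); the bare text follows by …FrameTransfer. -/
theorem volumeLimitTextV17F2_of_framedNestedFlowText
    (hS : ∀ (G : GeoConsts) (P : SplitConsts) (Q : EngConsts) (R : RenConsts), G.WF → P.WF → Q.WF → R.WF →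
      ∃ c₅ : ℝ, 0 < c₅ ∧ ∀ c : ℝ, 0 < c → c ≤ c₅ → ∃ U₀ : ℝ, 0 < U₀ ∧
        ∀ μ ∈ klWindowC, ∀ U : ℝ, 0 < U → U ≤ U₀ → ∀ β : ℝ, klBetaMin ≤ β → β ≤ Real.exp (c / U ^ 2) →
          ∀ K : TrigPolyC4v, klPredsV17F2.frameOK R U (nScales β) μ K →
            ∀ (Lstar : ℕ) (Mstar : ℕ → ℕ), TowerP klPredsV17F2 G P Q R β U μ K Lstar Mstar →
              ∀ n : ℤ, ∃ L₀ : ℕ, ∃ ρ : ℕ → ℝ, Tendsto ρ atTop (𝓝 0) ∧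
                ∀ (L : ℕ) [NeZero L], L₀ ≤ L → ∀ (L'' : ℕ) [NeZero L''], L ∣ L'' → ∃ M₀ : ℕ, ∀ (M : ℕ) [NeZero M], M₀ ≤ M →
                  ∀ (ω : MatsubaraIdx M), matsubaraInt M ω = n → ∀ (k : TorusSite 2 L) (k'' : TorusSite 2 L''),
                    latticeMomentum L'' k'' = latticeMomentum L k →
                      ‖klSelfEnergy L M β U μ (klFlowFrameU L M β U μ (nScales β + 1)) klE0 (nScales β + 1) (ω, k) 0 -
                          klSelfEnergy L'' M β U μ (klFlowFrameU L'' M β U μ (nScales β + 1)) klE0 (nScales β + 1) (ω, k'') 0‖ ≤ ρ L) :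
    VolumeLimitP2 klPredsV17F2 FinalTwoLegVolLimitEx klWindowC := by
  refine volumeLimitP2_of_perLabelThresholdsOnlyText klPredsV17F2 klWindowC klPredsV17F2_frameOK_frameOK ?_
  intro G P Q R hG hP hQ hR
  obtain ⟨c₅, hc₅, hc⟩ := hS G P Q R hG hP hQ hR
  refine ⟨c₅, hc₅, fun c hc0 hcc => ?_⟩
  obtain ⟨U₀, hU₀, hU⟩ := hc c hc0 hcc
  refine ⟨U₀, hU₀, fun μ hμ U hU0 hUU β hβmin hβmax K hK Lstar Mstar hT n => ?_⟩
  have hβ : 0 < β := pos_of_klBetaMin_le hβmin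
  have hSn := hU μ hμ U hU0 hUU β hβmin hβmax K hK Lstar Mstar hT n
  -- the frame family: the flow frames at the last scale; `Kmax := max 0 (Σ_{m ≤ n_β} Gfr 0·uPow 0 U·4^{−2m})`
  refine perLabelBare_of_framedFlow_eventually hβ hU0.ne' μ n (fun L M _ _ => klFlowFrameU L M β U μ (nScales β + 1))
    (Kmax := max 0 (∑ m ∈ range (nScales β + 1), R.Gfr 0 * uPow 0 U * (4 : ℝ) ^ ((((0 : ℕ) : ℤ) - 2) * (m : ℤ)))) (le_max_left _ _) ?_ hSn ?_
  · -- (o) the sup bound beyond the tower thresholds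
    refine ⟨Lstar, Mstar, fun L _ hL M _ hM q => ?_⟩
    exact (abs_eval_klFlowFrameU_le_of_towerV17F2 hT hL hM le_rfl q).trans (le_max_right _ _)
  · -- (ii) frame comparability on the coarse grid, rate `(Σ_{m ≤ n_β} Q.CL β m)/L`
    refine ⟨Lstar, fun L => (∑ m ∈ range (nScales β + 1), Q.CL β m) / L, tendsto_const_div_atTop_nhds_zero_nat _,
      fun L _ hL L'' _ hdvd => ?_⟩
    have hLL'' : L ≤ L'' := Nat.le_of_dvd (Nat.pos_of_ne_zero (NeZero.ne L'')) hdvd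
    refine ⟨max (max (Mstar L) (Mstar L'')) (max (Q.M0 β L) (Q.M0 β L'')), fun M _ hM k => ?_⟩
    exact flowFrames_twoVolume_of_towerV17F2 hμ hT hL hLL'' ((le_max_left _ _).trans ((le_max_left _ _).trans hM))
      ((le_max_left _ _).trans ((le_max_right _ _).trans hM)) ((le_max_right _ _).trans ((le_max_left _ _).trans hM))
      ((le_max_right _ _).trans ((le_max_right _ _).trans hM)) le_rfl _

/-! ## §3 (Appendix) The framed-flow export delivered in POSITION SPACE -/

/-- **(S_F) ⇒ framed nested comparability, one label** — for any frame family `Kf` on positive volumes/cutoffs: `ℓ¹` comparability of the site kernel of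
`Σ̂^{Kf L M}_{L,M}(ω,·)` with the periodised site kernel of `Σ̂^{Kf L″ M}_{L″,M}(ω,·)` (`L″ = b·L`, same cutoff, labels `matsubaraInt M ω = n`, threshold `L₀`,
rate `ρ`) gives the same-momentum comparability of the two framed carriers with the same threshold and rate. -/
theorem framedFlowNested_of_framedFlowSite {β U μ : ℝ} (n : ℤ) (Kf : (L M : ℕ) → [NeZero L] → [NeZero M] → TrigPolyC4v) {L₀ : ℕ} {ρ : ℕ → ℝ}
    (hS : ∀ (L : ℕ) [NeZero L], L₀ ≤ L → ∀ (L'' : ℕ) [NeZero L''] (b : ℕ), L'' = b * L → ∃ M₀ : ℕ, ∀ (M : ℕ) [NeZero M], M₀ ≤ M →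
      ∀ ω : MatsubaraIdx M, matsubaraInt M ω = n →
        ∑ y : TorusSite 2 L,
          ‖torusFourierInv (fun k : TorusSite 2 L => klSelfEnergy L M β U μ (Kf L M) klE0 (nScales β + 1) (ω, k) 0) y -
            ∑ x ∈ Finset.univ.filter (fun x : TorusSite 2 L'' => (fun i => (((x i).val : ℕ) : ZMod L)) = y),
              torusFourierInv (fun k : TorusSite 2 L'' => klSelfEnergy L'' M β U μ (Kf L'' M) klE0 (nScales β + 1) (ω, k) 0) x‖ ≤ ρ L) :
    ∀ (L : ℕ) [NeZero L], L₀ ≤ L → ∀ (L'' : ℕ) [NeZero L''], L ∣ L'' → ∃ M₀ : ℕ, ∀ (M : ℕ) [NeZero M], M₀ ≤ M →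
      ∀ (ω : MatsubaraIdx M), matsubaraInt M ω = n → ∀ (k : TorusSite 2 L) (k'' : TorusSite 2 L''),
        latticeMomentum L'' k'' = latticeMomentum L k →
          ‖klSelfEnergy L M β U μ (Kf L M) klE0 (nScales β + 1) (ω, k) 0 -
              klSelfEnergy L'' M β U μ (Kf L'' M) klE0 (nScales β + 1) (ω, k'') 0‖ ≤ ρ L := by
  intro L _ hL L'' _ hdvd
  obtain ⟨b, hb⟩ := hdvd
  have hM : L'' = b * L := hb.trans (mul_comm _ _)
  obtain ⟨M₀, hM₀⟩ := hS L hL L'' b hM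
  refine ⟨M₀, fun M _ hMM ω hω k k'' hkk => ?_⟩
  rw [eq_torusFourier_torusFourierInv (fun k : TorusSite 2 L => klSelfEnergy L M β U μ (Kf L M) klE0 (nScales β + 1) (ω, k) 0) k,
    eq_torusFourier_torusFourierInv (fun k : TorusSite 2 L'' => klSelfEnergy L'' M β U μ (Kf L'' M) klE0 (nScales β + 1) (ω, k) 0) k'']
  exact (norm_torusFourier_sub_torusFourier_of_latticeMomentum_eq hM _ _ hkk).trans (hM₀ M hMM ω hω)

/-- **The rev-22 VL child text from the framed-flow export in POSITION SPACE (S_F)** — inside the regime binders, for each Matsubara integer `n`: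
`∃ L₀ ρ, ρ → 0`, and `ℓ¹` comparability of the site kernel of the last-scale carrier at the flow frame `K^{(L,M)}_{n_β+1}` with the periodised site kernel of
the nested volume `L″ = b·L` at ITS flow frame `K^{(L″,M)}_{n_β+1}` (same cutoff) — frame comparability/bounds from the rev-2 tower, framed → bare by the exact
dressing, then the per-label doors. -/
theorem volumeLimitTextV17F2_of_framedFlowSiteText
    (hS : ∀ (G : GeoConsts) (P : SplitConsts) (Q : EngConsts) (R : RenConsts), G.WF → P.WF → Q.WF → R.WF →
      ∃ c₅ : ℝ, 0 < c₅ ∧ ∀ c : ℝ, 0 < c → c ≤ c₅ → ∃ U₀ : ℝ, 0 < U₀ ∧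
        ∀ μ ∈ klWindowC, ∀ U : ℝ, 0 < U → U ≤ U₀ → ∀ β : ℝ, klBetaMin ≤ β → β ≤ Real.exp (c / U ^ 2) →
          ∀ K : TrigPolyC4v, klPredsV17F2.frameOK R U (nScales β) μ K →
            ∀ (Lstar : ℕ) (Mstar : ℕ → ℕ), TowerP klPredsV17F2 G P Q R β U μ K Lstar Mstar →
              ∀ n : ℤ, ∃ L₀ : ℕ, ∃ ρ : ℕ → ℝ, Tendsto ρ atTop (𝓝 0) ∧
                ∀ (L : ℕ) [NeZero L], L₀ ≤ L → ∀ (L'' : ℕ) [NeZero L''] (b : ℕ), L'' = b * L → ∃ M₀ : ℕ, ∀ (M : ℕ) [NeZero M], M₀ ≤ M →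
                  ∀ ω : MatsubaraIdx M, matsubaraInt M ω = n →
                    ∑ y : TorusSite 2 L,
                      ‖torusFourierInv (fun k : TorusSite 2 L =>
                          klSelfEnergy L M β U μ (klFlowFrameU L M β U μ (nScales β + 1)) klE0 (nScales β + 1) (ω, k) 0) y -
                        ∑ x ∈ Finset.univ.filter (fun x : TorusSite 2 L'' => (fun i => (((x i).val : ℕ) : ZMod L)) = y),
                          torusFourierInv (fun k : TorusSite 2 L'' =>
                            klSelfEnergy L'' M β U μ (klFlowFrameU L'' M β U μ (nScales β + 1)) klE0 (nScales β + 1) (ω, k) 0) x‖ ≤ ρ L) :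
    VolumeLimitP2 klPredsV17F2 FinalTwoLegVolLimitEx klWindowC := by
  refine volumeLimitTextV17F2_of_framedNestedFlowText ?_
  intro G P Q R hG hP hQ hR
  obtain ⟨c₅, hc₅, hc⟩ := hS G P Q R hG hP hQ hR
  refine ⟨c₅, hc₅, fun c hc0 hcc => ?_⟩
  obtain ⟨U₀, hU₀, hU⟩ := hc c hc0 hcc
  refine ⟨U₀, hU₀, fun μ hμ U hU0 hUU β hβmin hβmax K hK Lstar Mstar hT n => ?_⟩
  obtain ⟨L₀, ρ, hρ, hSn⟩ := hU μ hμ U hU0 hUU β hβmin hβmax K hK Lstar Mstar hT n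
  exact ⟨L₀, ρ, hρ, framedFlowNested_of_framedFlowSite n (fun L M _ _ => klFlowFrameU L M β U μ (nScales β + 1)) hSn⟩


end Summit.HubbardSuperconductivity.HubbardSuperconductivity.Theorems.TwoPointAssembly

end
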